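import Summits.QuantumFields.BalabanUV.T4Continuum.Support.AveragingDeficitNearIdentity
import Summits.QuantumFields.BalabanUV.T4Continuum.Support.MinimalActionWitness
import HarnessLib

/-!
# AveragingDeficitCovGrad (T⁴ programme, node NE3, row NE3-R2, gen 5) — THE COVARIANT GRADIENT OF A DIRECTION FIELD and its
# comparison with the dressed curl: `‖(d_V ψ)(p′) − (D_μψ_ν − D_νψ_μ)(p′)‖ ≤ 2a·(two bond values)`, `curlSq ≤ 8·covGradSq + 32·d·a²·dirSq`
# (file 1 of (γ2), the gradient-bounded one-step lift — record `t4/T4-EST-NE3-R2.md` v0.6 §4)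

HONEST FRAMING (cell `pub-balaban`, T4-DAG PAGE 1; unit `b2b-balaban-t4-ne3r2-p1` = owner of BINDER-OWNERS row NE3-R2, gen 5).
The cell's T4 target is the finite-torus continuum limit of the unit-scale averaged loop expectations — NOT infinite volume, NO
mass gap, NOT Clay, NOT summit progress.  WHY.  In the weighted energy currency `N_k² = curlSq + L^{−2k}·dirSq` of the NE3 energy
route (GAPS G-ne7king10-1 REPAIR; this row's `NE3CoercivityScaling` excludes the unweighted one) the residual leaf must be
CURL-PAIRED: the wall β (`T4AveragingDeficitWall.DeficitDerivWall`, PROVED) pairs `‖∇_V F‖_{ℓ²}` with the dressed curl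
`‖d_V ψ‖_{ℓ²}` of the LIFTED direction, so the one-step lift must control the covariant GRADIENT of the lift by that of the datum
((γ2), v0.6 §4).  THIS FILE fixes the currency of that statement — the covariant gradient of a bond direction field in the tree's
conventions (`vary V ψ s = V·e^{sψ}`: `ψ(x,μ)` lives in the frame at `x + e_μ`; `Ad`, `curlAt` of `T4AveragingDeficitWall`) — and
proves the one inequality the re-assembled residual will use.  All [folklore], 0 sorry:
§1 `covFd V ψ x μ ν := Ad_{V(x,μ)V(x+e_μ,ν)} ψ(x+e_μ,ν) − Ad_{V(x,ν)} ψ(x,ν)` (the forward covariant difference of the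
   `ν`-component along `e_μ`, both values transported to the frame at `x`), `covGradSq V ψ F := Σ_{x∈F}Σ_{μ,ν}‖covFd V ψ x μ ν‖²`;
   at the flat configuration `covFd 1 ψ x μ ν = ψ(x+e_μ,ν) − ψ(x,ν)` (`covFd_flatCfg`);
§2 THE CURL IDENTITY `curlAt V ψ z μ ν = covFd V ψ z μ ν − covFd V ψ z ν μ + R` with the holonomy remainder
   `R = (Ad_{V₄V₃} − Ad_{V₁V₂}) ψ(z+e_ν,μ) + (Ad_{V₄} − Ad_{V₁V₂V₃⁻¹}) ψ(z,ν)` (`curlAt_eq_covFd_sub_add`), the group identities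
   `V₄V₃ = P⁻¹V₁V₂`, `V₁V₂V₃⁻¹ = P V₄` for the plaquette variable `P = V(∂p′)` (`hol_plaqWord_units`), and, for unitary `V` in
   `SmallField V a`, **`norm_curlAt_sub_covFd_le`**: `‖R‖ ≤ 2a·(‖ψ(z+e_ν,μ)‖ + ‖ψ(z,ν)‖)`;
§3 **`curlSq_le_covGradSq`**: for `M`-periodic `ψ`, `curlSq V ψ (periodBox M) ≤ 8·covGradSq V ψ (periodBox M) + 32·d·a²·dirSq ψ (periodBox M)`.
NE3 ITSELF IS NOT PROVED; nothing of Bałaban's is asserted (context: [Balaban1985Variational] (26)–(28) p. 282, the covariant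
derivatives `∇^η_U`; [Balaban1985BackgroundPropagators] (3.2)–(3.6) pp. 390–391).  ABSOLUTE RULE kept: no printed sentence is a
hypothesis.  PLACEMENT: `Summits/QuantumFields/BalabanUV/`; imports this row's accepted `Support.AveragingDeficitNearIdentity`
(for `Ad_one`, `norm_Ad_sub_le`, `norm_Ad_of_unitary`, `mem_U1_of_unitary`) and `Support.MinimalActionWitness` (`flatCfg`); moves nothing.
-/

set_option autoImplicit false

open scoped BigOperators Matrix Matrix.Norms.L2Operator
open NormedSpace Finset

namespace Summit.QuantumFields.BalabanUV.T4Continuum.AveragingDeficitCovGrad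

open Literature.MathematicalPhysics.QuantumFieldTheory.Balaban1983to89
open B7Prop1Explicit B7Prop2Explicit MatrixLog UnitaryModel
open T4AveragingDeficitWall hiding Site Plane Plaq Bond
open T4AveragingDeficitWallBoundary (periodBox sum_periodBox_shift)
open T4AveragingDeficitNonAbelian (Ad_mul Ad_sub)
open AveragingDeficitPeriodicCounting (IsPeriodicDir)
open AveragingDeficitTransport (norm_Ad_of_unitary mem_U1_of_unitary)
open AveragingDeficitNearIdentity (Ad_one norm_Ad_sub_le)
open AveragingDeficitLocality (dirGauge)
open MinimalActionWitness (flatCfg)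

noncomputable section

variable {d : ℕ} {n : Type*} [Fintype n] [DecidableEq n]

/-! ## §1 The covariant forward difference of a direction field -/

/-- THE COVARIANT FORWARD DIFFERENCE of the `ν`-component of a direction field along `e_μ`, based at `x`:
`Ad_{V(x,μ)V(x+e_μ,ν)} ψ(x+e_μ,ν) − Ad_{V(x,ν)} ψ(x,ν)` (in the convention `V_s = V·e^{sψ}` the value `ψ(x,μ)` lives in the frame
at `x + e_μ`; both values are transported to the frame at `x`). [folklore] -/
def covFd (V : Site d → Fin d → (Matrix n n ℂ)ˣ) (ψ : Site d → Fin d → Matrix n n ℂ) (x : Site d) (μ ν : Fin d) :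
    Matrix n n ℂ :=
  Ad (V x μ * V (x + e μ) ν) (ψ (x + e μ) ν) - Ad (V x ν) (ψ x ν)

/-- THE SQUARED `ℓ²` NORM OF THE COVARIANT GRADIENT over the site set `F`: `Σ_{x∈F} Σ_{μ,ν} ‖covFd V ψ x μ ν‖²`. [folklore] -/
def covGradSq (V : Site d → Fin d → (Matrix n n ℂ)ˣ) (ψ : Site d → Fin d → Matrix n n ℂ) (F : Finset (Site d)) : ℝ :=
  ∑ x ∈ F, ∑ μ : Fin d, ∑ ν : Fin d, ‖covFd V ψ x μ ν‖ ^ 2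

/-- `covGradSq ≥ 0`. [folklore] -/
theorem covGradSq_nonneg (V : Site d → Fin d → (Matrix n n ℂ)ˣ) (ψ : Site d → Fin d → Matrix n n ℂ) (F : Finset (Site d)) :
    0 ≤ covGradSq V ψ F := by
  unfold covGradSq; positivity

/-- At the flat configuration the covariant difference is the plain forward difference. [folklore] -/
theorem covFd_flatCfg (ψ : Site d → Fin d → Matrix n n ℂ) (x : Site d) (μ ν : Fin d) :
    covFd (flatCfg (d := d) (n := n)) ψ x μ ν = ψ (x + e μ) ν - ψ x ν := by
  simp [covFd, flatCfg, Ad_one]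

/-- **GAUGE COVARIANCE**: `covFd (V^u) (ψ^u) x μ ν = Ad_{u(x)} (covFd V ψ x μ ν)` (`ψ^u = dirGauge u ψ`, this row's
`AveragingDeficitLocality`). [cite: Balaban1985Averaging, (11) p.19] -/
theorem covFd_gaugeAct (u : Site d → (Matrix n n ℂ)ˣ) (V : Site d → Fin d → (Matrix n n ℂ)ˣ) (ψ : Site d → Fin d → Matrix n n ℂ)
    (x : Site d) (μ ν : Fin d) :
    covFd (gaugeAct u V) (dirGauge u ψ) x μ ν = Ad (u x) (covFd V ψ x μ ν) := by
  simp only [covFd, gaugeAct, dirGauge, ← Ad_mul, Ad_sub]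
  congr 2
  · group
  · group

/-- The covariant gradient energy is gauge invariant (unitary `u`). [folklore] -/
theorem covGradSq_gaugeAct {u : Site d → (Matrix n n ℂ)ˣ} (hu : ∀ x, u x ∈ unitaryUnits (Matrix n n ℂ))
    (V : Site d → Fin d → (Matrix n n ℂ)ˣ) (ψ : Site d → Fin d → Matrix n n ℂ) (F : Finset (Site d)) :
    covGradSq (gaugeAct u V) (dirGauge u ψ) F = covGradSq V ψ F := by
  unfold covGradSq
  simp only [covFd_gaugeAct, norm_Ad_of_unitary (hu _)]

/-! ## §2 The dressed curl against the antisymmetrised covariant gradient -/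

/-- THE HOLONOMY REMAINDER of the curl identity at the plaquette `(z; μ, ν)`. [folklore] -/
def curlRem (V : Site d → Fin d → (Matrix n n ℂ)ˣ) (ψ : Site d → Fin d → Matrix n n ℂ) (z : Site d) (μ ν : Fin d) :
    Matrix n n ℂ :=
  (Ad (V z ν * V (z + e ν) μ) (ψ (z + e ν) μ) - Ad (V z μ * V (z + e μ) ν) (ψ (z + e ν) μ))
    + (Ad (V z ν) (ψ z ν) - Ad (V z μ * V (z + e μ) ν * (V (z + e ν) μ)⁻¹) (ψ z ν))

/-- **THE CURL IDENTITY**: `(d_V ψ)(z; μ, ν) = D_μψ_ν(z) − D_νψ_μ(z) + curlRem`. [folklore] -/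
theorem curlAt_eq_covFd_sub_add (V : Site d → Fin d → (Matrix n n ℂ)ˣ) (ψ : Site d → Fin d → Matrix n n ℂ) (z : Site d)
    (μ ν : Fin d) :
    curlAt V ψ z μ ν = covFd V ψ z μ ν - covFd V ψ z ν μ + curlRem V ψ z μ ν := by
  simp only [curlAt, covFd, curlRem]
  abel

/-- The plaquette variable in the group of units: `V(∂p′) = V₁ V₂ V₃⁻¹ V₄⁻¹`. [folklore] -/
theorem hol_plaqWord_units (V : Site d → Fin d → (Matrix n n ℂ)ˣ) (z : Site d) (μ ν : Fin d) :
    hol V z (plaqWord μ ν) = V z μ * V (z + e μ) ν * (V (z + e ν) μ)⁻¹ * (V z ν)⁻¹ := by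
  apply Units.ext
  rw [val_hol_plaqWord]
  simp only [Units.val_mul, mul_assoc]

/-- `V₄ V₃ = V(∂p′)⁻¹ · V₁ V₂`. [folklore] -/
theorem units_id₁ (V : Site d → Fin d → (Matrix n n ℂ)ˣ) (z : Site d) (μ ν : Fin d) :
    V z ν * V (z + e ν) μ = (hol V z (plaqWord μ ν))⁻¹ * (V z μ * V (z + e μ) ν) := by
  rw [hol_plaqWord_units]; group

/-- `V₁ V₂ V₃⁻¹ = V(∂p′) · V₄`. [folklore] -/
theorem units_id₂ (V : Site d → Fin d → (Matrix n n ℂ)ˣ) (z : Site d) (μ ν : Fin d) :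
    V z μ * V (z + e μ) ν * (V (z + e ν) μ)⁻¹ = hol V z (plaqWord μ ν) * V z ν := by
  rw [hol_plaqWord_units]; group

/-- `‖Ad_{P⁻¹} Y − Y‖ ≤ 2‖P − 1‖·‖Y‖` for unitary `P`. [folklore] -/
theorem norm_Ad_inv_sub_le [Nonempty n] {P : (Matrix n n ℂ)ˣ} (hP : P ∈ unitaryUnits (Matrix n n ℂ)) (Y : Matrix n n ℂ) :
    ‖Ad P⁻¹ Y - Y‖ ≤ 2 * ‖(P : Matrix n n ℂ) - 1‖ * ‖Y‖ := by
  have hPi : P⁻¹ ∈ unitaryUnits (Matrix n n ℂ) := (unitaryUnits (Matrix n n ℂ)).inv_mem hP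
  refine (norm_Ad_sub_le hPi Y).trans ?_
  have h := norm_inv_sub_one_le (mem_U1_of_unitary hP)
  gcongr

/-- **THE REMAINDER IS `O(a)`**: for unitary `V` with `|V(∂p′) − 1| ≤ a`,
`‖curlRem V ψ z μ ν‖ ≤ 2a·(‖ψ(z+e_ν,μ)‖ + ‖ψ(z,ν)‖)`. [folklore] -/
theorem norm_curlRem_le [Nonempty n] {V : Site d → Fin d → (Matrix n n ℂ)ˣ} (hV : IsUnitaryCfg V)
    (ψ : Site d → Fin d → Matrix n n ℂ) (z : Site d) {μ ν : Fin d} {a : ℝ}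
    (hP : ‖((hol V z (plaqWord μ ν) : (Matrix n n ℂ)ˣ) : Matrix n n ℂ) - 1‖ ≤ a) :
    ‖curlRem V ψ z μ ν‖ ≤ 2 * a * (‖ψ (z + e ν) μ‖ + ‖ψ z ν‖) := by
  set P : (Matrix n n ℂ)ˣ := hol V z (plaqWord μ ν) with hPdef
  have hPu : P ∈ unitaryUnits (Matrix n n ℂ) := hol_mem_of hV _ _
  have h12 : V z μ * V (z + e μ) ν ∈ unitaryUnits (Matrix n n ℂ) :=
    (unitaryUnits _).mul_mem (hV z μ) (hV (z + e μ) ν)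
  have ha : 0 ≤ a := (norm_nonneg _).trans hP
  -- first term: `Ad_{V₄V₃} Y₃ − Ad_{V₁V₂} Y₃ = Ad_{P⁻¹} W − W`, `W = Ad_{V₁V₂} Y₃`
  have t1 : ‖Ad (V z ν * V (z + e ν) μ) (ψ (z + e ν) μ) - Ad (V z μ * V (z + e μ) ν) (ψ (z + e ν) μ)‖
      ≤ 2 * a * ‖ψ (z + e ν) μ‖ := by
    rw [units_id₁, Ad_mul]
    refine (norm_Ad_inv_sub_le hPu _).trans ?_
    rw [norm_Ad_of_unitary h12]
    gcongr
  -- second term: `Ad_{V₄} Y₄ − Ad_{P V₄} Y₄ = −(Ad_P W − W)`, `W = Ad_{V₄} Y₄`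
  have t2 : ‖Ad (V z ν) (ψ z ν) - Ad (V z μ * V (z + e μ) ν * (V (z + e ν) μ)⁻¹) (ψ z ν)‖ ≤ 2 * a * ‖ψ z ν‖ := by
    rw [units_id₂, Ad_mul, ← norm_neg, neg_sub]
    refine (norm_Ad_sub_le hPu _).trans ?_
    rw [norm_Ad_of_unitary (hV z ν)]
    gcongr
  calc ‖curlRem V ψ z μ ν‖ ≤ _ + _ := norm_add_le _ _
    _ ≤ 2 * a * ‖ψ (z + e ν) μ‖ + 2 * a * ‖ψ z ν‖ := add_le_add t1 t2
    _ = 2 * a * (‖ψ (z + e ν) μ‖ + ‖ψ z ν‖) := by ring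

/-- **THE DRESSED CURL AGAINST THE ANTISYMMETRISED COVARIANT GRADIENT** (unitary `V`, small field `a` at the plaquette):
`‖(d_V ψ)(z;μ,ν) − (D_μψ_ν − D_νψ_μ)(z)‖ ≤ 2a·(‖ψ(z+e_ν,μ)‖ + ‖ψ(z,ν)‖)`. [folklore] -/
theorem norm_curlAt_sub_covFd_le [Nonempty n] {V : Site d → Fin d → (Matrix n n ℂ)ˣ} (hV : IsUnitaryCfg V)
    (ψ : Site d → Fin d → Matrix n n ℂ) (z : Site d) {μ ν : Fin d} {a : ℝ}
    (hP : ‖((hol V z (plaqWord μ ν) : (Matrix n n ℂ)ˣ) : Matrix n n ℂ) - 1‖ ≤ a) :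
    ‖curlAt V ψ z μ ν - (covFd V ψ z μ ν - covFd V ψ z ν μ)‖ ≤ 2 * a * (‖ψ (z + e ν) μ‖ + ‖ψ z ν‖) := by
  rw [curlAt_eq_covFd_sub_add, add_sub_cancel_left]
  exact norm_curlRem_le hV ψ z hP

/-- Pointwise square bound: `‖(d_V ψ)(p′)‖² ≤ 4(‖D_μψ_ν‖² + ‖D_νψ_μ‖² + 4a²‖ψ(z+e_ν,μ)‖² + 4a²‖ψ(z,ν)‖²)`. [folklore] -/
theorem norm_curlAt_sq_le [Nonempty n] {V : Site d → Fin d → (Matrix n n ℂ)ˣ} (hV : IsUnitaryCfg V)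
    (ψ : Site d → Fin d → Matrix n n ℂ) (z : Site d) {μ ν : Fin d} {a : ℝ}
    (hP : ‖((hol V z (plaqWord μ ν) : (Matrix n n ℂ)ˣ) : Matrix n n ℂ) - 1‖ ≤ a) :
    ‖curlAt V ψ z μ ν‖ ^ 2
      ≤ 4 * (‖covFd V ψ z μ ν‖ ^ 2 + ‖covFd V ψ z ν μ‖ ^ 2
          + 4 * a ^ 2 * ‖ψ (z + e ν) μ‖ ^ 2 + 4 * a ^ 2 * ‖ψ z ν‖ ^ 2) := by
  have h := norm_curlAt_sub_covFd_le hV ψ z hP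
  have ha : 0 ≤ a := (norm_nonneg _).trans hP
  set A := ‖covFd V ψ z μ ν‖
  set B := ‖covFd V ψ z ν μ‖
  set C := ‖ψ (z + e ν) μ‖
  set D := ‖ψ z ν‖
  have htri : ‖curlAt V ψ z μ ν‖ ≤ A + B + 2 * a * C + 2 * a * D := by
    have h1 : ‖curlAt V ψ z μ ν‖ ≤ ‖covFd V ψ z μ ν - covFd V ψ z ν μ‖
        + ‖curlAt V ψ z μ ν - (covFd V ψ z μ ν - covFd V ψ z ν μ)‖ := by
      have := norm_add_le (covFd V ψ z μ ν - covFd V ψ z ν μ) (curlAt V ψ z μ ν - (covFd V ψ z μ ν - covFd V ψ z ν μ))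
      rwa [add_sub_cancel] at this
    have h2 : ‖covFd V ψ z μ ν - covFd V ψ z ν μ‖ ≤ A + B := norm_sub_le _ _
    linarith
  have hA : 0 ≤ A := norm_nonneg _
  have hB : 0 ≤ B := norm_nonneg _
  have hC : 0 ≤ C := norm_nonneg _
  have hD : 0 ≤ D := norm_nonneg _
  have hn : 0 ≤ ‖curlAt V ψ z μ ν‖ := norm_nonneg _
  nlinarith [sq_nonneg (A - B), sq_nonneg (A - 2 * a * C), sq_nonneg (A - 2 * a * D), sq_nonneg (B - 2 * a * C),
    sq_nonneg (B - 2 * a * D), sq_nonneg (2 * a * C - 2 * a * D), mul_nonneg ha hC, mul_nonneg ha hD]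

/-! ## §3 The period sum: `curlSq ≤ 8·covGradSq + 32·d·a²·dirSq` -/

/-- Sums over ordered planes `μ < ν` are dominated by sums over all ordered pairs (non-negative summands). [folklore] -/
theorem sum_plane_le_sum_pair (f : Fin d → Fin d → ℝ) (hf : ∀ μ ν, 0 ≤ f μ ν) :
    ∑ π : T4AveragingDeficitWall.Plane d, f π.1.1 π.1.2 ≤ ∑ μ : Fin d, ∑ ν : Fin d, f μ ν := by
  have hset : ∀ q : Fin d × Fin d,
      q ∈ (Finset.univ : Finset (Fin d × Fin d)).filter (fun q => q.1 < q.2) ↔ q.1 < q.2 := fun q => by simp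
  rw [← Finset.sum_subtype ((Finset.univ : Finset (Fin d × Fin d)).filter (fun q => q.1 < q.2)) hset
    (fun q : Fin d × Fin d => f q.1 q.2), ← Fintype.sum_prod_type (f := fun q : Fin d × Fin d => f q.1 q.2)]
  exact Finset.sum_le_sum_of_subset_of_nonneg (Finset.filter_subset _ _) (fun q _ _ => hf q.1 q.2)

/-- **`curlSq ≤ 8·covGradSq + 32·d·a²·dirSq` ON ONE PERIOD** for a unitary `V` in `SmallField V a` and an `M`-periodic
direction field `ψ` (planes over-counted as ordered pairs; periodic shifts by `sum_periodBox_shift`). [folklore] -/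
theorem curlSq_le_covGradSq [Nonempty n] {M : ℕ} (hM : 1 ≤ M) {V : Site d → Fin d → (Matrix n n ℂ)ˣ} (hV : IsUnitaryCfg V)
    {a : ℝ} (hVa : SmallField V a) {ψ : Site d → Fin d → Matrix n n ℂ} (hψ : IsPeriodicDir ψ (M : ℤ)) :
    curlSq V ψ (periodBox M) ≤ 8 * covGradSq V ψ (periodBox M) + 32 * d * a ^ 2 * dirSq ψ (periodBox M) := by
  -- per-pair and per-direction period sums (as explicit functions)
  have hshift : ∀ (ν μ : Fin d),
      ∑ z ∈ periodBox (d := d) M, ‖ψ (z + e ν) μ‖ ^ 2 = ∑ z ∈ periodBox (d := d) M, ‖ψ z μ‖ ^ 2 :=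
    fun ν μ => sum_periodBox_shift M hM (g := fun x => ‖ψ x μ‖ ^ 2) (fun x κ => by simp only [hψ x κ μ]) (e ν)
  have hcov : covGradSq V ψ (periodBox M)
      = ∑ μ : Fin d, ∑ ν : Fin d, ∑ z ∈ periodBox (d := d) M, ‖covFd V ψ z μ ν‖ ^ 2 := by
    unfold covGradSq
    rw [Finset.sum_comm]
    exact Finset.sum_congr rfl fun μ _ => Finset.sum_comm
  have hdir : dirSq ψ (periodBox M) = ∑ κ : Fin d, ∑ z ∈ periodBox (d := d) M, ‖ψ z κ‖ ^ 2 := by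
    unfold dirSq; rw [Finset.sum_comm]
  -- the per-pair majorant
  let f : Fin d → Fin d → ℝ := fun μ ν =>
    4 * (∑ z ∈ periodBox (d := d) M, ‖covFd V ψ z μ ν‖ ^ 2 + ∑ z ∈ periodBox (d := d) M, ‖covFd V ψ z ν μ‖ ^ 2)
      + 16 * a ^ 2 * (∑ z ∈ periodBox (d := d) M, ‖ψ z μ‖ ^ 2 + ∑ z ∈ periodBox (d := d) M, ‖ψ z ν‖ ^ 2)
  have hf0 : ∀ μ ν, 0 ≤ f μ ν := fun μ ν => by positivity
  -- pointwise bound summed over the period, plane by plane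
  have hplane : curlSq V ψ (periodBox M) ≤ ∑ π : T4AveragingDeficitWall.Plane d, f π.1.1 π.1.2 := by
    unfold curlSq
    rw [Finset.sum_comm]
    refine Finset.sum_le_sum fun π _ => ?_
    calc ∑ z ∈ periodBox M, ‖curl V ψ (z, π)‖ ^ 2
        ≤ ∑ z ∈ periodBox M, (4 * (‖covFd V ψ z π.1.1 π.1.2‖ ^ 2 + ‖covFd V ψ z π.1.2 π.1.1‖ ^ 2
            + 4 * a ^ 2 * ‖ψ (z + e π.1.2) π.1.1‖ ^ 2 + 4 * a ^ 2 * ‖ψ z π.1.2‖ ^ 2)) :=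
          Finset.sum_le_sum fun z _ => by
            rw [curl]; exact norm_curlAt_sq_le hV ψ z (hVa z π.1.1 π.1.2 (ne_of_lt π.2))
      _ = f π.1.1 π.1.2 := by
          simp only [f, mul_add, Finset.sum_add_distrib, ← Finset.mul_sum, hshift π.1.2 π.1.1]
          ring
  -- over-count planes by ordered pairs, then evaluate
  have hpairs := sum_plane_le_sum_pair f hf0
  have hsum : ∑ μ : Fin d, ∑ ν : Fin d, f μ ν
      = 8 * covGradSq V ψ (periodBox M) + 32 * d * a ^ 2 * dirSq ψ (periodBox M) := by
    have hsym : ∑ μ : Fin d, ∑ ν : Fin d, ∑ z ∈ periodBox (d := d) M, ‖covFd V ψ z ν μ‖ ^ 2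
        = ∑ μ : Fin d, ∑ ν : Fin d, ∑ z ∈ periodBox (d := d) M, ‖covFd V ψ z μ ν‖ ^ 2 := Finset.sum_comm
    have e2 : ∑ μ : Fin d, ∑ _ν : Fin d, ∑ z ∈ periodBox (d := d) M, ‖ψ z μ‖ ^ 2 = (d : ℝ) * dirSq ψ (periodBox M) := by
      rw [hdir, Finset.mul_sum]
      simp only [Finset.sum_const, Finset.card_univ, Fintype.card_fin, nsmul_eq_mul]
    have e3 : ∑ _μ : Fin d, ∑ ν : Fin d, ∑ z ∈ periodBox (d := d) M, ‖ψ z ν‖ ^ 2 = (d : ℝ) * dirSq ψ (periodBox M) := by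
      rw [hdir]
      simp only [Finset.sum_const, Finset.card_univ, Fintype.card_fin, nsmul_eq_mul]
    simp only [f, mul_add, Finset.sum_add_distrib, ← Finset.mul_sum]
    rw [hsym, e2, e3, hcov]
    ring
  linarith

end

end Summit.QuantumFields.BalabanUV.T4Continuum.AveragingDeficitCovGrad
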